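import Literature.AlgebraicTopology.FundamentalGroup.IsotopyTrack
import HarnessLib

/-!
# Moving the base point of a realised automorphism along a path, after a correction isotopic to the identity

Topic `Literature/AlgebraicTopology/FundamentalGroup` (supporting the fact seat
`provefact-Literature.Topology.FourManifolds.lauden-f709dd520c`, Laudenbach–Poénaru's Lemma 2: the
self-diffeomorphisms realising the Nielsen moves are built fixing an interior base point `x₀`,
while the lemma is stated at a boundary point `z`).  Pure algebraic topology; everything
**proved**, no named facts.

* `pathConj ζ : π₁(Y, x₀) ≃* π₁(Y, z)` — transport along a path `ζ : z ⟶ x₀`,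
  `c ↦ [ζ · c · ζ⁻¹]` (an abbreviation for Mathlib's `(fundamentalGroupMulEquivOfPath ζ).symm`).
* `mapOfEq_comp_pathConj` — let `G : Y → Y` fix `x₀`, let `ρ ≃ id` by a homotopy `F`
  (in the application: an ambient isotopy pushing `G z` back to `z`), with `ρ (G z) = z`.  Then
  on `π₁(Y, z)`, **`(ρ ∘ G)_# ∘ T_ζ = conj(d) ∘ T_ζ ∘ G_#`** for the explicit class
  `d⁻¹ = [t⁻¹ · G∘ζ · ζ⁻¹]`, `t` the track of `G z` under `F` (Hatcher's Lemma 1.19 for `ρ`,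
  and reassociation).  So automorphisms realised at `x₀` are realised at `z` up to an inner
  automorphism.

## References

* A. Hatcher, *Algebraic Topology* (2002), §1.1, Prop. 1.5 (change of base point), Lemma 1.19.
  [HatcherAT2002]
* F. Laudenbach, V. Poénaru, Bull. Soc. Math. France 100 (1972), §2 (p. 339). [LaudenbachPoenaruBSMF1972]
-/

noncomputable section

open scoped unitInterval
open Set Function

namespace Literature.AlgebraicTopology.FundamentalGroup

namespace BasePointTransfer

variable {Y : Type*} [TopologicalSpace Y]

/-- **Transport of `π₁` along a path** `ζ : z ⟶ x₀`: `c ↦ [ζ · c · ζ⁻¹]`, Mathlib's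
`(FundamentalGroup.fundamentalGroupMulEquivOfPath ζ).symm` (Hatcher's `β_h` with `h = ζ⁻¹`).
[cite: HatcherAT2002, Prop. 1.5] -/
abbrev pathConj {z x₀ : Y} (ζ : Path z x₀) : FundamentalGroup Y x₀ ≃* FundamentalGroup Y z :=
  (FundamentalGroup.fundamentalGroupMulEquivOfPath ζ).symm

/-- Unfolding of `pathConj` on the class of a loop (definitional). [folklore] -/
theorem pathConj_fromPath {z x₀ : Y} (ζ : Path z x₀) (γ : Path x₀ x₀) :
    pathConj ζ (FundamentalGroup.fromPath (Path.Homotopic.Quotient.mk γ)) =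
      FundamentalGroup.fromPath (Path.Homotopic.Quotient.mk (ζ.trans (γ.trans ζ.symm))) := rfl

/-- Unfolding of `pathConj` on a class. [folklore] -/
theorem pathConj_apply {z x₀ : Y} (ζ : Path z x₀) (c : FundamentalGroup Y x₀) :
    pathConj ζ c = FundamentalGroup.fromPath ((Path.Homotopic.Quotient.mk ζ).trans ((FundamentalGroup.toPath c).trans
      (Path.Homotopic.Quotient.mk ζ).symm)) := by
  induction c using Quotient.ind with | _ γ =>
  change pathConj ζ (FundamentalGroup.fromPath (Path.Homotopic.Quotient.mk γ)) =
    FundamentalGroup.fromPath ((Path.Homotopic.Quotient.mk ζ).trans ((Path.Homotopic.Quotient.mk γ).trans (Path.Homotopic.Quotient.mk ζ).symm))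
  rw [pathConj_fromPath, Path.Homotopic.Quotient.mk_trans, Path.Homotopic.Quotient.mk_trans, Path.Homotopic.Quotient.mk_symm]

/-- Reassociation: `t⁻¹ · A · B · A⁻¹ · t = (t⁻¹ · A · ζ⁻¹) · (ζ · B · ζ⁻¹) · (t⁻¹ · A · ζ⁻¹)⁻¹`. [folklore] -/
theorem quotient_reassoc {z y x₀ : Y} (t : Path.Homotopic.Quotient y z) (A : Path.Homotopic.Quotient y x₀)
    (B : Path.Homotopic.Quotient x₀ x₀) (ζ : Path.Homotopic.Quotient z x₀) :
    (t.symm.trans ((A.trans (B.trans A.symm)).trans t)) =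
      (((t.symm.trans A).trans ζ.symm).trans (ζ.trans (B.trans ζ.symm))).trans ((t.symm.trans A).trans ζ.symm).symm := by
  simp only [Path.Homotopic.Quotient.trans_assoc, IsotopyTrack.quotient_symm_trans, IsotopyTrack.quotient_symm_symm,
    IsotopyTrack.quotient_symm_trans_trans]

/-- Bookkeeping for `mapOfEq_comp_pathConj`: the track formula, read with supplied paths. [folklore] -/
theorem cast_track_eq {a w z x₀ : Y} (Fev : Path a w) (L : Path a a) (e : w = z) (t : Path a z)
    (ht : ∀ s, t s = Fev s) (A : Path a x₀) (B : Path x₀ x₀) (hL : ∀ s, L s = (A.trans (B.trans A.symm)) s) :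
    ((((Path.Homotopic.Quotient.mk Fev).symm.trans (Path.Homotopic.Quotient.mk L)).trans
        (Path.Homotopic.Quotient.mk Fev)).cast e.symm e.symm) =
      (Path.Homotopic.Quotient.mk t).symm.trans ((((Path.Homotopic.Quotient.mk A).trans
        ((Path.Homotopic.Quotient.mk B).trans (Path.Homotopic.Quotient.mk A).symm))).trans (Path.Homotopic.Quotient.mk t)) := by
  subst e
  have et : t = Fev := Path.ext (funext ht)
  have eL : L = A.trans (B.trans A.symm) := Path.ext (funext hL)
  subst et eL
  simp only [Path.Homotopic.Quotient.cast_rfl_rfl, Path.Homotopic.Quotient.mk_trans, Path.Homotopic.Quotient.mk_symm,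
    Path.Homotopic.Quotient.trans_assoc]

/-- **Moving the base point after a correction isotopic to the identity** (see the module
docstring): for `G` fixing `x₀`, `ρ ≃ id` by `F` with `ρ (G z) = z`, a path `ζ : z ⟶ x₀`, the
track `t : G z ⟶ z` of `G z` under `F` and the path `A = G ∘ ζ : G z ⟶ x₀` (both supplied
pointwise), and every `c ∈ π₁(Y, x₀)`:
`(ρ ∘ G)_# (T_ζ c) = d * T_ζ (G_# c) * d⁻¹` with `d = [t⁻¹ · A · ζ⁻¹]⁻¹`.
[cite: HatcherAT2002, Lemma 1.19, Prop. 1.5] -/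
theorem mapOfEq_comp_pathConj (G ρ : C(Y, Y)) (F : ContinuousMap.Homotopy (ContinuousMap.id Y) ρ)
    {x₀ z : Y} (hx₀ : G x₀ = x₀) (hz : ρ (G z) = z) (ζ : Path z x₀)
    (t : Path (G z) z) (ht : ∀ s, t s = F (s, G z)) (A : Path (G z) x₀) (hA : ∀ s, A s = G (ζ s))
    (c : FundamentalGroup Y x₀) :
    FundamentalGroup.mapOfEq (ρ.comp G) hz (pathConj ζ c) =
      (FundamentalGroup.fromPath (((Path.Homotopic.Quotient.mk t).symm.trans (Path.Homotopic.Quotient.mk A)).trans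
          (Path.Homotopic.Quotient.mk ζ).symm))⁻¹ *
        pathConj ζ (FundamentalGroup.mapOfEq G hx₀ c) *
      FundamentalGroup.fromPath (((Path.Homotopic.Quotient.mk t).symm.trans (Path.Homotopic.Quotient.mk A)).trans
          (Path.Homotopic.Quotient.mk ζ).symm) := by
  induction c using Quotient.ind with | _ γ =>
  change FundamentalGroup.mapOfEq (ρ.comp G) hz (pathConj ζ (FundamentalGroup.fromPath (Path.Homotopic.Quotient.mk γ))) =
    _ * pathConj ζ (FundamentalGroup.mapOfEq G hx₀ (FundamentalGroup.fromPath (Path.Homotopic.Quotient.mk γ))) * _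
  rw [pathConj_fromPath]
  -- the image of `G_# [γ]`, transported: supplied pointwise as `B`
  set B : Path x₀ x₀ := (γ.map (map_continuous G)).cast hx₀.symm hx₀.symm with hB
  have hGγ : FundamentalGroup.mapOfEq G hx₀ (FundamentalGroup.fromPath (Path.Homotopic.Quotient.mk γ)) =
      FundamentalGroup.fromPath (Path.Homotopic.Quotient.mk B) := by
    rw [FundamentalGroup.mapOfEq_apply]
    change (Path.Homotopic.Quotient.map (Path.Homotopic.Quotient.mk γ) G).cast hx₀.symm hx₀.symm = _
    rw [← Path.Homotopic.Quotient.mk_map, ← Path.Homotopic.Quotient.mk_cast]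
  rw [hGγ, pathConj_fromPath]
  -- the left-hand side: `[(ζ γ ζ⁻¹) ∘ (ρ ∘ G)]`, cast to `z`
  rw [FundamentalGroup.mapOfEq_apply]
  change (Path.Homotopic.Quotient.map (Path.Homotopic.Quotient.mk (ζ.trans (γ.trans ζ.symm))) (ρ.comp G)).cast hz.symm hz.symm = _
  rw [← Path.Homotopic.Quotient.mk_map, ← Path.Homotopic.Quotient.mk_cast]
  -- Hatcher's Lemma 1.19 for `ρ ≃ id` on the loop `(ζ γ ζ⁻¹) ∘ G`
  set L : Path (G z) (G z) := (ζ.trans (γ.trans ζ.symm)).map (map_continuous G) with hL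
  have key := IsotopyTrack.mk_map_eq_of_homotopy F L
  have eid : L.map (map_continuous (ContinuousMap.id Y)) = L := by ext s; rfl
  rw [eid] at key
  -- rewrite everything with the supplied paths `t`, `A`, `B`
  have e1 : (ζ.trans (γ.trans ζ.symm)).map (map_continuous (ρ.comp G)) = L.map (map_continuous ρ) := by ext s; rfl
  have hLpt : ∀ s, L s = (A.trans (B.trans A.symm)) s := fun s => by
    show G ((ζ.trans (γ.trans ζ.symm)) s) = (A.trans (B.trans A.symm)) s
    simp only [Path.trans_apply, Path.symm_apply]
    split_ifs <;> simp only [Function.comp_apply, hA, hB, Path.cast_coe, Path.map_coe]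
  rw [e1, Path.Homotopic.Quotient.mk_cast]
  refine (congrArg (fun q => Path.Homotopic.Quotient.cast q hz.symm hz.symm) key).trans ?_
  rw [cast_track_eq (F.evalAt (G z)) L hz t (fun s => ht s) A B hLpt]
  -- the right-hand side, as one class
  rw [FundamentalGroup.inv_def, FundamentalGroup.mul_def, FundamentalGroup.mul_def]
  change _ = Path.Homotopic.Quotient.trans (((Path.Homotopic.Quotient.mk t).symm.trans (Path.Homotopic.Quotient.mk A)).trans
      (Path.Homotopic.Quotient.mk ζ).symm)
    (Path.Homotopic.Quotient.trans (Path.Homotopic.Quotient.mk (ζ.trans (B.trans ζ.symm)))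
      (Path.Homotopic.Quotient.symm (((Path.Homotopic.Quotient.mk t).symm.trans (Path.Homotopic.Quotient.mk A)).trans
        (Path.Homotopic.Quotient.mk ζ).symm)))
  rw [Path.Homotopic.Quotient.mk_trans, Path.Homotopic.Quotient.mk_trans, Path.Homotopic.Quotient.mk_symm]
  exact (quotient_reassoc (Path.Homotopic.Quotient.mk t) (Path.Homotopic.Quotient.mk A) (Path.Homotopic.Quotient.mk B)
    (Path.Homotopic.Quotient.mk ζ)).trans (Path.Homotopic.Quotient.trans_assoc _ _ _)

end BasePointTransfer

end Literature.AlgebraicTopology.FundamentalGroup
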